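import Summits.BirchSwinnertonDyer.Rank1Residual.GaloisImage.KolyvaginDerivativeInertiaLocal
import Summits.BirchSwinnertonDyer.Rank1Residual.GaloisImage.KolyvaginDerivativeUnramified
import Summits.BirchSwinnertonDyer.Rank1Residual.GaloisImage.TateModuleFrobeniusPowInjective
import Literature.NumberTheory.EllipticCurves.GoodReductionUnramifiedProofs
import Literature.NumberTheory.EllipticCurves.IsogenyFrobeniusTraceProofs
import Literature.NumberTheory.GaloisRepresentations.CyclotomicLevels
import HarnessLib

/-!
# Every class of `H¹(U, T_p E)` is unramified at the good places `v ∤ p` unramified in `U`, and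
# Kolyvagin's derivative classes of `T_p E` are unramified away from `r p` (E-side END of THEOREM B)
# (cell `b2b-bsdres`, team n1011, seat p11 GEN 8, OWNERS row T-DER = skel/T-DER.md STATUS v5; file F8)

HONEST FRAMING (cell `b2b-bsdres`, run/shared/lean/b2b/bsd-rank1-residual/, verbatim in every
file): the goal of the cell is to DELETE the COMBINATION-SHAPED residual classes of the
Birch–Swinnerton-Dyer formula for ALL analytic-rank `≤ 1` elliptic curves over `ℚ` — "full BSD
formula for every rank `≤ 1` curve in class `C`" assembled STRICTLY from published theorems — so
that the rank-`≤ 1` remainder becomes exactly the CONSTRUCTION-SHAPED classes, which are TYPED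
(missing-input `Prop`s), NOT attempted. This is not "finishing BSD". Team n1011 (N10 / N11, the
additive block X4 ∧ `p = 3`): research route on the CONSTRUCTION-SHAPED class X4; no claim beyond the
stated classes; nothing is booked. TOOL theorems (no definition, no named fact, no `sorry`); no
Euler system is asserted to exist and no Selmer structure occurs; closes nothing by itself.

## What

* `apply_eq_zero_of_mem_inertia_tate` — **every class of `H¹(U, T_p E)`, `U ⊴ Γ_K` open and
  unramified at a good `v ∤ p`, has all its representatives vanishing on every inertia group above
  `v`**: F6 `Inertia.apply_eq_zero_of_mem_inertia` with `hX` = `isUnramifiedAt_tateGaloisRep`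
  (Silverman VII.4.1), `hV` = `exists_addSubgroup_tateModule` and `hFrob` =
  `injective_galoisRepTate_pow_sub` (F8a).  Rubin, PCMS 18, §3.1 p. 30: "`Hom(I_{ℚ_ℓ}, A)` is
  torsion-free, so `H¹_{𝓕can}(ℚ_ℓ, A) = H¹_u(ℚ_ℓ, A)`" with Prop. 1.4.13 (2) — i.e.
  `H¹(K_w, T_p E) = H¹_u(K_w, T_p E)` at such `w`; Rubin, *Euler Systems*, Lemma 1.3.5.
* `apply_eq_zero_of_resSubgroup_eq_deriv_tate` — **hence every derivative class `κ` with
  `res_U κ = D_r (red_* x)`, for a coefficient map `red : T_p E ⟶ T′` to a representation on which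
  the inertia groups above `v` act trivially and ANY `x ∈ H¹(U, T_p E)`, has all its
  representatives vanishing on every `I_𝔓`, `𝔓 ∣ v`** (F7's THEOREM B-ur
  `apply_eq_zero_of_resSubgroup_eq_deriv` with its input `hx` discharged).
* `Rat.apply_eq_zero_of_resSubgroup_eq_deriv_cyclotomicLevelsRat` — the reading over the
  cyclotomic levels of `ℚ` (`U = Gal(ℚ̄/ℚ(μ_r))`, `v` a usable prime of `cyclotomicLevelsRat p S`
  outside `r`, so `v ∤ p` and `U` is unramified at `v` by `EulerSystemLevels.level_unramifiedAt`),
  the form in which the `κ_r` of THEOREM A3 / F5 (`Rat.exists_sigma_existsUnique_res_eq_deriv_tate`,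
  `T′` killed by `p^k`, `r` a level of Kolyvagin primes) is consumed.
[Rubin00] Thm. 4.5.1 / [MR04] Prop. A.2 and Remark A.5 at the good primes `ℓ ∤ r p` (`κ_r` is
UNRAMIFIED there).  SCOPE: the places `v ∣ N`, `v ∣ p` ([MR04] Lemma A.1, D7) and `v ∣ ∞` are not
treated (skel/T-DER.md STATUS v5); the `ℤ`-currency reading `loc_v κ_r ∈ H¹_ur` rides on p13's
coefficient transport (`CoeffTransport`, `TorsionCoeff`) and `SelmerFinite.localization_mem_unramifiedSubgroup_of_forall_primesAbove` (F9).

References: K. Rubin, *Euler Systems* (2000), Thm. 4.5.1, Lemma 1.3.5; B. Mazur, K. Rubin, Mem.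
AMS 799 (2004), App. A, Prop. A.2, Remark A.5 (pp. 79–81); K. Rubin, PCMS 18 (2011), Prop. 1.4.13
(2) (p. 9), §3.1 (p. 30), Exercise 3.1.6 (2), Thm. 4.3.10 (1); J. H. Silverman, *AEC*, VII.4.1.
-/

noncomputable section

open CategoryTheory Function Finset Polynomial Field IsDedekindDomain
open scoped NumberField
open Literature.NumberTheory.GaloisRepresentations Literature.NumberTheory.EllipticCurves

universe u

namespace Summit.BirchSwinnertonDyer.Rank1Residual.GaloisImage

namespace Derivative

section Tate

variable {K : Type u} [Field K] [NumberField K] (W : WeierstrassCurve K) [W.IsElliptic]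
  (p : ℕ) [Fact p.Prime]

/-! ### §3 THEOREM B for `T_p E`: classes of `H¹(U, T_p E)` and the derivative classes -/

variable (hT : Continuous fun x : absoluteGaloisGroup K × W.tateModule p => W.galoisRepTate p x.1 x.2)

/-- **Every class of `H¹(U, T_p E)` is unramified at a good place `v ∤ p` unramified in `U`.**
For `U ⊴ Γ_K` open with `I_𝔓 ≤ U` for all `𝔓 ∣ v`, `v ∤ p` a place of good reduction, EVERY
continuous crossed homomorphism `φ : U → T_p E` vanishes on every `I_𝔓`, `𝔓 ∣ v`: F6
`Inertia.apply_eq_zero_of_mem_inertia` with `hX` = `isUnramifiedAt_tateGaloisRep` (Silverman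
VII.4.1), `hV` = `exists_addSubgroup_tateModule`, `hFrob` = `injective_galoisRepTate_pow_sub`.
(Rubin, PCMS 18, §3.1 p. 30 and Prop. 1.4.13 (2): `H¹(K_w, T_p E) = H¹_u(K_w, T_p E)` at such `w`;
Rubin, *Euler Systems*, Lemma 1.3.5.)  The three instance arguments are the tree's
`W.module_free_tateModule_holds p`, `W.module_finite_tateModule_holds p`,
`TateModule.continuousSMul_padicInt` (supply with `haveI`).
[cite: Rubin2011, §3.1 (p. 30) and Prop. 1.4.13 (2) (p. 9)] [cite: SilvermanAEC2009, Prop. VII.4.1 and Thm. V.1.1] -/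
theorem apply_eq_zero_of_mem_inertia_tate [ContinuousSMul ℤ_[p] (W.tateModule p)]
    {U : Subgroup (absoluteGaloisGroup K)} [U.Normal] (hU : IsOpen (U : Set (absoluteGaloisGroup K)))
    {v : HeightOneSpectrum (𝓞 K)} (hIU : SubgroupIsUnramifiedAt K U v)
    (hpv : ((p : ℕ) : 𝓞 K) ∉ v.asIdeal) (hv : W.HasGoodReductionAt v)
    (φ : contOneCocycles (subgroupRep (W.tateGaloisRep p hT).toTopRep U))
    {𝔓 : Ideal (absIntegers (𝓞 K) K)} (h𝔓 : 𝔓 ∈ v.primesAbove) {σ : absoluteGaloisGroup K}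
    (hσ : σ ∈ 𝔓.inertia (absoluteGaloisGroup K)) : φ.1 ⟨σ, hIU 𝔓 h𝔓 hσ⟩ = 0 := by
  refine Inertia.apply_eq_zero_of_mem_inertia (W.tateGaloisRep p hT).toTopRep hIU hU ?_ ?_ ?_ φ h𝔓 hσ
  · intro 𝔓' h𝔓' τ hτ x
    have h := W.isUnramifiedAt_tateGaloisRep p hT hv hpv 𝔓' h𝔓' τ hτ
    exact LinearMap.congr_fun h x
  · exact fun x hx => exists_addSubgroup_tateModule W p hpv x hx
  · intro 𝔓' h𝔓' τ hτ m hm _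
    exact injective_galoisRepTate_pow_sub W p hpv hv h𝔓' hτ hm

/-- **Kolyvagin's derivative classes of `T_p E` are unramified at the good places away from `r p`.**
For `U ⊴ Γ_K` open and unramified at `v` (`I_𝔓 ≤ U`, `𝔓 ∣ v`; for the Euler-system levels
`U = Gal(K̄/K(r))`, `v ∉ r` usable: `EulerSystemLevels.level_unramifiedAt`), `v ∤ p` of good
reduction, a coefficient map `red : T_p E ⟶ T′` to a representation on which every `I_𝔓`, `𝔓 ∣ v`,
acts trivially, and ANY class `x ∈ H¹(U, T_p E)`: every `κ ∈ H¹(Γ_K, T′)` with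
`res_U κ = D_r (red_* x)` (THEOREM A3's shape; `κ = κ_r` for `x = c_{⊥,r}`) has all its
representatives vanishing on every `I_𝔓`, `𝔓 ∣ v`.  F7 `apply_eq_zero_of_resSubgroup_eq_deriv`
with its input discharged by `apply_eq_zero_of_mem_inertia_tate`.  ([Rubin00] Thm. 4.5.1 /
[MR04] Prop. A.2 and Remark A.5 at the good primes `ℓ ∤ r p`: `κ_r` is UNRAMIFIED there.)
[cite: Rubin2000, Thm. 4.5.1] [cite: MazurRubin2004, App. A Prop. A.2 and Remark A.5 (pp. 79–81)] -/
theorem apply_eq_zero_of_resSubgroup_eq_deriv_tate [ContinuousSMul ℤ_[p] (W.tateModule p)]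
    {U : Subgroup (absoluteGaloisGroup K)} [U.Normal] (hU : IsOpen (U : Set (absoluteGaloisGroup K)))
    {v : HeightOneSpectrum (𝓞 K)} (hIU : SubgroupIsUnramifiedAt K U v)
    (hpv : ((p : ℕ) : 𝓞 K) ∉ v.asIdeal) (hv : W.HasGoodReductionAt v)
    {X' : TopRep.{u} ℤ_[p] (absoluteGaloisGroup K)} (red : (W.tateGaloisRep p hT).toTopRep ⟶ X')
    (hX' : ∀ 𝔓 ∈ v.primesAbove, ∀ g ∈ 𝔓.inertia (absoluteGaloisGroup K), ∀ x : X', X'.ρ g x = x)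
    (x : continuousCohomology 1 (subgroupRep (W.tateGaloisRep p hT).toTopRep U))
    {ι : Type*} (r : Finset ι) (σ : ι → absoluteGaloisGroup K) (N : ι → ℕ) (comm)
    (κ : continuousCohomology 1 X')
    (hκ : resSubgroup X' U 1 κ = (r.noncommProd (fun ℓ => ∑ j ∈ range (N ℓ),
        (j : Module.End ℤ_[p] (continuousCohomology 1 (subgroupRep X' U))) *
          (conjMap X' U (σ ℓ) 1).hom.toLinearMap ^ j) comm)
      (ContinuousCohomology.map (ContinuousMonoidHom.id U)
        (X := subgroupRep (W.tateGaloisRep p hT).toTopRep U) (Y := subgroupRep X' U)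
        ((TopRep.resFunctor U.subtype).map red) 1 x))
    (Φ : contOneCocycles X') (hΦ : oneCocycleClass X' Φ = κ)
    {𝔓 : Ideal (absIntegers (𝓞 K) K)} (h𝔓 : 𝔓 ∈ v.primesAbove) {g : absoluteGaloisGroup K}
    (hg : g ∈ 𝔓.inertia (absoluteGaloisGroup K)) : Φ.1 g = 0 :=
  apply_eq_zero_of_resSubgroup_eq_deriv (W.tateGaloisRep p hT).toTopRep X' U red hIU hX' x
    (fun φ _ _ h𝔓' _ hg' => apply_eq_zero_of_mem_inertia_tate W p hT hU hIU hpv hv φ h𝔓' hg')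
    r σ N comm κ hκ Φ hΦ h𝔓 hg

/-! ### Over the cyclotomic levels of `ℚ` -/

/-- **Kolyvagin's derivative classes of `T_p E` over `ℚ(μ_r)` are unramified at the usable primes
outside `r`.**  For `E/ℚ`, the cyclotomic levels `cyclotomicLevelsRat p S`, a level `r`, a usable
prime `v ∉ r` (`v ∉ S`, `v ≠ p`: `mem_cyclotomicLevelsRat_primes_iff`) of good reduction, a
coefficient map `red : T_p E ⟶ T′` with the inertia groups above `v` trivial on `T′`, and ANY class
`x ∈ H¹(Gal(ℚ̄/ℚ(μ_r)), T_p E)` (e.g. an Euler-system class `c_{0,r}`): every `κ ∈ H¹(Γ_ℚ, T′)` with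
`res κ = D_r (red_* x)` — in particular the `κ_r` of F5
`Rat.exists_sigma_existsUnique_res_eq_deriv_tate` — has all its representatives vanishing on every
`I_𝔓`, `𝔓 ∣ v`.  (`Gal(ℚ̄/ℚ(μ_r))` is unramified at `v` by `EulerSystemLevels.level_unramifiedAt`.)
[cite: Rubin2000, Thm. 4.5.1] [cite: MazurRubin2004, App. A Prop. A.2 and Remark A.5 (pp. 79–81)] -/
theorem Rat.apply_eq_zero_of_resSubgroup_eq_deriv_cyclotomicLevelsRat (W : WeierstrassCurve ℚ)
    [W.IsElliptic] (p : ℕ) [Fact p.Prime] [ContinuousSMul ℤ_[p] (W.tateModule p)]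
    (S : Set (HeightOneSpectrum (𝓞 ℚ))) (r : (cyclotomicLevelsRat p S).Ideals)
    {v : HeightOneSpectrum (𝓞 ℚ)} (hvS : v ∈ (cyclotomicLevelsRat p S).primes) (hvr : v ∉ r.1)
    (hv : W.HasGoodReductionAt v)
    {X' : TopRep.{0} ℤ_[p] (absoluteGaloisGroup ℚ)}
    (red : (W.tateGaloisRep p (W.continuous_galoisRepTate_holds p)).toTopRep ⟶ X')
    (hX' : ∀ 𝔓 ∈ v.primesAbove, ∀ g ∈ 𝔓.inertia (absoluteGaloisGroup ℚ), ∀ x : X', X'.ρ g x = x)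
    (x : continuousCohomology 1
      (subgroupRep (W.tateGaloisRep p (W.continuous_galoisRepTate_holds p)).toTopRep
        ((cyclotomicLevelsRat p S).level ⊥ r.1)))
    {ι : Type*} (rr : Finset ι) (σ : ι → absoluteGaloisGroup ℚ) (N : ι → ℕ) (comm)
    (κ : continuousCohomology 1 X')
    (hκ : resSubgroup X' ((cyclotomicLevelsRat p S).level ⊥ r.1) 1 κ =
      (rr.noncommProd (fun ℓ => ∑ j ∈ range (N ℓ),
        (j : Module.End ℤ_[p] (continuousCohomology 1
          (subgroupRep X' ((cyclotomicLevelsRat p S).level ⊥ r.1)))) *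
          (conjMap X' ((cyclotomicLevelsRat p S).level ⊥ r.1) (σ ℓ) 1).hom.toLinearMap ^ j) comm)
      (ContinuousCohomology.map (ContinuousMonoidHom.id _)
        (X := subgroupRep (W.tateGaloisRep p (W.continuous_galoisRepTate_holds p)).toTopRep
          ((cyclotomicLevelsRat p S).level ⊥ r.1))
        (Y := subgroupRep X' ((cyclotomicLevelsRat p S).level ⊥ r.1))
        ((TopRep.resFunctor ((cyclotomicLevelsRat p S).level ⊥ r.1).subtype).map red) 1 x))
    (Φ : contOneCocycles X') (hΦ : oneCocycleClass X' Φ = κ)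
    {𝔓 : Ideal (absIntegers (𝓞 ℚ) ℚ)} (h𝔓 : 𝔓 ∈ v.primesAbove) {g : absoluteGaloisGroup ℚ}
    (hg : g ∈ 𝔓.inertia (absoluteGaloisGroup ℚ)) : Φ.1 g = 0 := by
  have hvU : SubgroupIsUnramifiedAt ℚ ((cyclotomicLevelsRat p S).level ⊥ r.1) v :=
    (cyclotomicLevelsRat p S).level_unramifiedAt ⊥ r hvS hvr
  have hne : ((Rat.HeightOneSpectrum.primesEquiv v : Nat.Primes) : ℕ) ≠ p :=
    ((mem_cyclotomicLevelsRat_primes_iff p S v).mp hvS).2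
  have hpv : ((p : ℕ) : 𝓞 ℚ) ∉ v.asIdeal :=
    WeierstrassCurve.natCast_not_mem_asIdeal_of_primesEquiv_ne Fact.out hne
  exact apply_eq_zero_of_resSubgroup_eq_deriv_tate W p (W.continuous_galoisRepTate_holds p)
    ((cyclotomicLevelsRat p S).isOpen_level ⊥ r.1) hvU hpv hv red hX' x rr σ N comm κ hκ Φ hΦ h𝔓 hg

end Tate

end Derivative

end Summit.BirchSwinnertonDyer.Rank1Residual.GaloisImage

end
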